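import Summits.QuantumAdvantage.AdviceFreeQNC0.AffBells21MaskedPhi
import HarnessLib

/-!
# Cell qa-qnc0, plan S2 cube side: the ONE-PATH DESCENT and its leaf — toward the generic-systems rung (P2-generic)

Support for crux `RingDenseResidualLt3` (stmt-QuantumAdvantage-22907), route `DWalkThree`; planner qa-qnc0-p1 g21
ROUND-20 §2.8 (P2-generic) / §2.9′ ("ONE-PATH FORM: one certified child per level suffices").

From the descent lemma (DL, `AffBells21.descentLemma`) with the fifteen other children bounded by `|bias| ≤ 1`:
`1 − |bias(S)| ≥ (1 − |bias(child_{x,x'})|)/32` for ANY off-diagonal child (`one_path_step`).  Three moves along the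
fixed path `x = (0,0)`, `x' = (1,0)` at the coin pairs `(0,1), (2,3), (4,5)` give the LEAF: the rows with
`B_{k,0} B_{k,2} B_{k,4} ≠ 0` survive (`survS`) with the six coins zeroed (`leafB_apply`), every other row is dead
(zero row, residue `1`, `leafR_of_not_mem`).  The masked (PHI) (`abs_bias_le_masked`) then bounds the leaf by
`3^{−|S|} + Ψ(B)` with `Ψ(B) = 3^{−|S|} Σ_{ξ ≠ 0, supp ξ ⊆ S} 2^{wt ξ} 2^{−wtR(ξB)}` (`Psi`, off-six weight `wtR`), so
**`one_sub_abs_bias_ge`**: `(1 − 3^{−|S|} − Ψ(B))/32768 ≤ 1 − |bias(B, r, λ)|` for every system with `q ≥ 6` coins,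
uniformly in the residues `r` and the linear term `λ`.  Small tools for the counting file: `sum_zmod3_real`,
`pow_card_filter_eq_prod_ite`, `three_mul_card_orth` (a non-zero linear form on `𝔽₃^s` vanishes on exactly `3^{s−1}`
vectors, by orthogonality of characters) and the one-column factor `sum_col_weight`.

WHAT THIS IS NOT: the counting over `B` (Markov for `Ψ`, the empty-survivor count) and the rung itself are in
`AffBells21GenericCount.lean` / `AffBells21Generic.lean`; nothing here touches the crux.
-/

namespace Summit.QuantumAdvantage.AdviceFreeQNC0

open Finset
open Literature.Computability.MetaComplexity

namespace AffBells21

variable {q s : ℕ}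

/-! ## `|bias| ≤ 1` and the one-path descent inequality -/

/-- `|bias| ≤ 1` (an average of signs). -/
theorem abs_bias_le_one (B : Fin s → Fin q → ZMod 3) (r : Fin s → ZMod 3) (lam : Fin q → Bool) :
    |bias q s B r lam| ≤ 1 := by
  unfold bias
  rw [abs_div, abs_of_pos (by positivity : (0 : ℝ) < 2 ^ q), div_le_one (by positivity)]
  refine (Finset.abs_sum_le_sum_abs _ _).trans (le_of_eq ?_)
  rw [sum_congr rfl fun F _ => abs_neg_one_pow _, sum_const, card_univ, Fintype.card_fun, Fintype.card_bool,
    Fintype.card_fin]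
  simp

/-- **One-path step of the descent**: for ANY off-diagonal child `(x₀, x₀')` of the pair `a ≠ b`,
`1 − |bias(S)| ≥ (1 − |bias(child_{x₀,x₀'})|)/32` — (DL) with the fifteen other children bounded by `1`. -/
theorem one_path_step (B : Fin s → Fin q → ZMod 3) (r : Fin s → ZMod 3) (lam : Fin q → Bool) {a b : Fin q}
    (hab : a ≠ b) (x₀ x₀' : Bool × Bool) :
    (1 - |bias q s (childB B a b x₀ x₀') (childR B r a b x₀ x₀') (fun _ => false)|) / 32
      ≤ 1 - |bias q s B r lam| := by
  have hDL := descentLemma q s B r lam a b hab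
  have hsum : ∑ x : Bool × Bool, ∑ x' : Bool × Bool,
      |bias q s (childB B a b x x') (childR B r a b x x') (fun _ => false)|
        = ∑ p : (Bool × Bool) × (Bool × Bool),
            |bias q s (childB B a b p.1 p.2) (childR B r a b p.1 p.2) (fun _ => false)| :=
    (Fintype.sum_prod_type' (fun x x' => |bias q s (childB B a b x x') (childR B r a b x x') (fun _ => false)|)).symm
  have hle : ∑ p : (Bool × Bool) × (Bool × Bool),
      |bias q s (childB B a b p.1 p.2) (childR B r a b p.1 p.2) (fun _ => false)|
        ≤ 15 + |bias q s (childB B a b x₀ x₀') (childR B r a b x₀ x₀') (fun _ => false)| := by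
    rw [← Finset.add_sum_erase univ
      (fun p : (Bool × Bool) × (Bool × Bool) =>
        |bias q s (childB B a b p.1 p.2) (childR B r a b p.1 p.2) (fun _ => false)|) (mem_univ (x₀, x₀'))]
    have h15 : ∑ p ∈ (univ : Finset ((Bool × Bool) × (Bool × Bool))).erase (x₀, x₀'),
        |bias q s (childB B a b p.1 p.2) (childR B r a b p.1 p.2) (fun _ => false)| ≤ 15 := by
      calc ∑ p ∈ (univ : Finset ((Bool × Bool) × (Bool × Bool))).erase (x₀, x₀'),
            |bias q s (childB B a b p.1 p.2) (childR B r a b p.1 p.2) (fun _ => false)|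
          ≤ ∑ p ∈ (univ : Finset ((Bool × Bool) × (Bool × Bool))).erase (x₀, x₀'), (1 : ℝ) :=
            sum_le_sum fun p _ => abs_bias_le_one _ _ _
        _ = 15 := by
            rw [sum_const, card_erase_of_mem (mem_univ _), card_univ]
            norm_num [Fintype.card_prod, Fintype.card_bool]
    linarith
  have h0 : 0 ≤ |bias q s B r lam| := abs_nonneg _
  have h1 : |bias q s B r lam| ≤ 1 := abs_bias_le_one _ _ _
  have hsq : |bias q s B r lam| ^ 2
      ≤ (1 / 16 : ℝ) * (15 + |bias q s (childB B a b x₀ x₀') (childR B r a b x₀ x₀') (fun _ => false)|) := by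
    rw [sq_abs]
    rw [hsum] at hDL
    exact hDL.trans (by gcongr)
  nlinarith [hsq, h0, h1, sq_nonneg (1 - |bias q s B r lam|)]

/-! ## The descent path: three pair moves with `x = (0,0)`, `x' = (1,0)` -/

/-- One move along the path: the child at `x = (0,0)`, `x' = (1,0)` of the pair `(a, b)`. -/
def stepB (B : Fin s → Fin q → ZMod 3) (a b : Fin q) : Fin s → Fin q → ZMod 3 :=
  childB B a b (false, false) (true, false)

/-- Its residues. -/
def stepR (B : Fin s → Fin q → ZMod 3) (r : Fin s → ZMod 3) (a b : Fin q) : Fin s → ZMod 3 :=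
  childR B r a b (false, false) (true, false)

/-- Row `k` survives the move iff `B_{ka} ≠ 0`; survivors keep the row with columns `a, b` zeroed. -/
theorem stepB_apply (B : Fin s → Fin q → ZMod 3) (a b : Fin q) (k : Fin s) (j : Fin q) :
    stepB B a b k j = if B k a ≠ 0 then (if j = a ∨ j = b then 0 else B k j) else 0 := by
  by_cases h : B k a = 0
  · simp [stepB, childB, pairVal, h]
  · simp [stepB, childB, pairVal, h, Ne.symm h]

/-- A row killed by the move gets residue `1`. -/
theorem stepR_apply_of_eq_zero (B : Fin s → Fin q → ZMod 3) (r : Fin s → ZMod 3) (a b : Fin q) (k : Fin s)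
    (h : B k a = 0) : stepR B r a b k = 1 := by
  simp [stepR, childR, pairVal, h]

section Path

variable (hq : 6 ≤ q)

/-- The six distinguished coins `0,…,5` of `Fin q` (`q ≥ 6`). -/
def cix (i : Fin 6) : Fin q := Fin.castLE hq i

/-- The six coins are distinct. -/
theorem cix_inj {i j : Fin 6} : cix hq i = cix hq j ↔ i = j := (Fin.castLE_injective hq).eq_iff

/-- The value of a distinguished coin. -/
theorem cix_val (i : Fin 6) : (cix hq i).val = i.val := rfl

/-- `j` is one of the six coins iff `j.val < 6`. -/
theorem eq_cix_iff (j : Fin q) (i : Fin 6) : j = cix hq i ↔ j.val = i.val := by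
  rw [Fin.ext_iff, cix_val]

/-- Survivors of the whole path: rows with `B_{k,0}, B_{k,2}, B_{k,4}` all non-zero. -/
def survS (B : Fin s → Fin q → ZMod 3) : Finset (Fin s) :=
  univ.filter fun k => B k (cix hq 0) ≠ 0 ∧ B k (cix hq 2) ≠ 0 ∧ B k (cix hq 4) ≠ 0

/-- The leaf system after three moves. -/
def leafB (B : Fin s → Fin q → ZMod 3) : Fin s → Fin q → ZMod 3 :=
  stepB (stepB (stepB B (cix hq 0) (cix hq 1)) (cix hq 2) (cix hq 3)) (cix hq 4) (cix hq 5)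

/-- Its residues. -/
def leafR (B : Fin s → Fin q → ZMod 3) (r : Fin s → ZMod 3) : Fin s → ZMod 3 :=
  stepR (stepB (stepB B (cix hq 0) (cix hq 1)) (cix hq 2) (cix hq 3))
    (stepR (stepB B (cix hq 0) (cix hq 1)) (stepR B r (cix hq 0) (cix hq 1)) (cix hq 2) (cix hq 3))
    (cix hq 4) (cix hq 5)

/-- Closed form of the leaf rows: survivors keep their row with the six coins zeroed, the rest is dead. -/
theorem leafB_apply (B : Fin s → Fin q → ZMod 3) (k : Fin s) (j : Fin q) :
    leafB hq B k j = if k ∈ survS hq B then (if j.val < 6 then 0 else B k j) else 0 := by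
  have hmem : k ∈ survS hq B ↔ (B k (cix hq 0) ≠ 0 ∧ B k (cix hq 2) ≠ 0 ∧ B k (cix hq 4) ≠ 0) := by
    simp [survS]
  have h6 : (j.val < 6) ↔ (j = cix hq 0 ∨ j = cix hq 1 ∨ j = cix hq 2 ∨ j = cix hq 3 ∨ j = cix hq 4 ∨ j = cix hq 5) := by
    simp only [eq_cix_iff]
    simp only [Fin.val_zero, Fin.val_one, Fin.val_two]
    constructor
    · intro h; omega
    · intro h; omega
  unfold leafB
  simp only [stepB_apply, cix_inj]
  by_cases h0 : B k (cix hq 0) = 0 <;> by_cases h2 : B k (cix hq 2) = 0 <;> by_cases h4 : B k (cix hq 4) = 0 <;>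
    by_cases hj : j.val < 6 <;>
    simp_all [Fin.ext_iff]
  all_goals omega

/-- Dead rows of the leaf carry residue `1`. -/
theorem leafR_of_not_mem (B : Fin s → Fin q → ZMod 3) (r : Fin s → ZMod 3) {k : Fin s} (hk : k ∉ survS hq B) :
    leafR hq B r k = 1 := by
  unfold leafR
  apply stepR_apply_of_eq_zero
  simp only [stepB_apply, cix_inj]
  have : ¬ (B k (cix hq 0) ≠ 0 ∧ B k (cix hq 2) ≠ 0 ∧ B k (cix hq 4) ≠ 0) := by simpa [survS] using hk
  by_cases h0 : B k (cix hq 0) = 0 <;> by_cases h2 : B k (cix hq 2) = 0 <;> by_cases h4 : B k (cix hq 4) = 0 <;>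
    simp_all

/-- The one-path step in `stepB`/`stepR` form. -/
theorem one_path_stepB (B : Fin s → Fin q → ZMod 3) (r : Fin s → ZMod 3) (lam : Fin q → Bool) {a b : Fin q}
    (hab : a ≠ b) :
    (1 - |bias q s (stepB B a b) (stepR B r a b) (fun _ => false)|) / 32 ≤ 1 - |bias q s B r lam| :=
  one_path_step B r lam hab (false, false) (true, false)

/-- Three one-path steps: `1 − |bias(B,r,λ)| ≥ (1 − |bias(leaf, 0)|)/32³`. -/
theorem one_path_three (B : Fin s → Fin q → ZMod 3) (r : Fin s → ZMod 3) (lam : Fin q → Bool) :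
    (1 - |bias q s (leafB hq B) (leafR hq B r) (fun _ => false)|) / 32768 ≤ 1 - |bias q s B r lam| := by
  have h01 : cix hq 0 ≠ cix hq 1 := by rw [Ne, cix_inj]; decide
  have h23 : cix hq 2 ≠ cix hq 3 := by rw [Ne, cix_inj]; decide
  have h45 : cix hq 4 ≠ cix hq 5 := by rw [Ne, cix_inj]; decide
  have s1 := one_path_stepB B r lam h01
  have s2 := one_path_stepB (stepB B (cix hq 0) (cix hq 1)) (stepR B r (cix hq 0) (cix hq 1)) (fun _ => false) h23
  have s3 := one_path_stepB (stepB (stepB B (cix hq 0) (cix hq 1)) (cix hq 2) (cix hq 3))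
    (stepR (stepB B (cix hq 0) (cix hq 1)) (stepR B r (cix hq 0) (cix hq 1)) (cix hq 2) (cix hq 3))
    (fun _ => false) h45
  unfold leafB leafR
  linarith

/-! ## The leaf potential -/

/-- Weight of a dual vector. -/
def wt3 (ξ : Fin s → ZMod 3) : ℕ := (univ.filter fun k : Fin s => ξ k ≠ 0).card

/-- Off-six weight of `ξB`: columns `j ≥ 6` with `(ξB)_j ≠ 0`. -/
def wtR (ξ : Fin s → ZMod 3) (B : Fin s → Fin q → ZMod 3) : ℕ :=
  (univ.filter fun j : Fin q => ¬ (j.val < 6) ∧ (∑ k : Fin s, ξ k * B k j) ≠ 0).card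

/-- The leaf potential without its `ξ = 0` term:
`Ψ(B) = 3^{−|S|} Σ_{ξ ≠ 0, supp ξ ⊆ S} 2^{wt ξ} 2^{−wtR(ξB)}`, `S` = survivors of the path. -/
noncomputable def Psi (B : Fin s → Fin q → ZMod 3) : ℝ :=
  ∑ ξ ∈ (univ : Finset (Fin s → ZMod 3)).filter (fun ξ => ξ ≠ 0 ∧ ∀ k, k ∉ survS hq B → ξ k = 0),
    (3 : ℝ)⁻¹ ^ (survS hq B).card * (2 : ℝ) ^ wt3 ξ * (2 : ℝ)⁻¹ ^ wtR ξ B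

/-- The weight of `ξ · leaf` is the off-six weight of `ξB` (for `supp ξ ⊆ S`). -/
theorem card_leaf_weight (B : Fin s → Fin q → ZMod 3) (ξ : Fin s → ZMod 3)
    (hξ : ∀ k, k ∉ survS hq B → ξ k = 0) :
    (univ.filter fun j : Fin q => (∑ k : Fin s, ξ k * leafB hq B k j) ≠ 0).card = wtR ξ B := by
  unfold wtR
  congr 1
  refine filter_congr fun j _ => ?_
  by_cases hj : j.val < 6
  · have h0 : (∑ k : Fin s, ξ k * leafB hq B k j) = 0 := by
      refine sum_eq_zero fun k _ => ?_
      rw [leafB_apply]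
      split_ifs <;> simp
    simp [h0, hj]
  · have h1 : (∑ k : Fin s, ξ k * leafB hq B k j) = ∑ k : Fin s, ξ k * B k j := by
      refine sum_congr rfl fun k _ => ?_
      rw [leafB_apply]
      by_cases hk : k ∈ survS hq B
      · rw [if_pos hk, if_neg hj]
      · rw [if_neg hk, hξ k hk]; simp
    simp [h1, hj]

/-- **The leaf bound**: `|bias(leaf, 0)| ≤ 3^{−|S|} + Ψ(B)`. -/
theorem abs_bias_leaf_le (B : Fin s → Fin q → ZMod 3) (r : Fin s → ZMod 3) :
    |bias q s (leafB hq B) (leafR hq B r) (fun _ => false)| ≤ (3 : ℝ)⁻¹ ^ (survS hq B).card + Psi hq B := by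
  have hdeadB : ∀ k, k ∉ survS hq B → leafB hq B k = 0 := by
    intro k hk
    funext j
    rw [leafB_apply, if_neg hk]
    rfl
  have hdeadR : ∀ k, k ∉ survS hq B → leafR hq B r k ≠ 0 := by
    intro k hk
    rw [leafR_of_not_mem hq B r hk]
    exact one_ne_zero
  refine (abs_bias_le_masked (leafB hq B) (leafR hq B r) (survS hq B) hdeadB hdeadR).trans (le_of_eq ?_)
  -- split off the `ξ = 0` term and identify the weights
  have hsplit : (univ : Finset (Fin s → ZMod 3)).filter (fun ξ => ∀ k, k ∉ survS hq B → ξ k = 0)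
      = insert 0 ((univ : Finset (Fin s → ZMod 3)).filter
          (fun ξ => ξ ≠ 0 ∧ ∀ k, k ∉ survS hq B → ξ k = 0)) := by
    ext ξ
    simp only [mem_filter, mem_univ, true_and, mem_insert]
    by_cases h : ξ = 0
    · subst h; simp
    · simp [h]
  have hnot : (0 : Fin s → ZMod 3) ∉ (univ : Finset (Fin s → ZMod 3)).filter
      (fun ξ => ξ ≠ 0 ∧ ∀ k, k ∉ survS hq B → ξ k = 0) := by simp
  rw [hsplit, sum_insert hnot]
  unfold Psi
  congr 1
  · simp
  · refine sum_congr rfl fun ξ hξ => ?_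
    rw [card_leaf_weight hq B ξ (mem_filter.mp hξ).2.2]
    rfl

/-- **Root bound along the path**: for every system `(B, r, λ)` with `q ≥ 6`,
`(1 − 3^{−|S|} − Ψ(B))/32768 ≤ 1 − |bias(B, r, λ)|`. -/
theorem one_sub_abs_bias_ge (B : Fin s → Fin q → ZMod 3) (r : Fin s → ZMod 3) (lam : Fin q → Bool) :
    (1 - ((3 : ℝ)⁻¹ ^ (survS hq B).card + Psi hq B)) / 32768 ≤ 1 - |bias q s B r lam| := by
  have h1 := one_path_three hq B r lam
  have h2 := abs_bias_leaf_le hq B r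
  linarith [div_le_div_of_nonneg_right (by linarith : 1 - ((3 : ℝ)⁻¹ ^ (survS hq B).card + Psi hq B)
    ≤ 1 - |bias q s (leafB hq B) (leafR hq B r) (fun _ => false)|) (by norm_num : (0:ℝ) ≤ 32768)]

end Path

/-! ## Small tools -/

/-- Sums over `𝔽₃`, explicitly. -/
theorem sum_zmod3_real (f : ZMod 3 → ℝ) : ∑ a, f a = f 0 + f 1 + f 2 := by
  have h : (univ : Finset (ZMod 3)) = {0, 1, 2} := by decide
  rw [h, sum_insert (by decide), sum_insert (by decide), sum_singleton, add_assoc]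

/-- `c^{#{i : p i}} = Π_i (p i ? c : 1)`. -/
theorem pow_card_filter_eq_prod_ite {ι : Type*} [Fintype ι] (c : ℝ) (p : ι → Prop) [DecidablePred p] :
    c ^ (univ.filter p).card = ∏ i, (if p i then c else 1) := by
  rw [prod_ite, prod_const_one, mul_one, prod_const]

/-- **Level sets of a non-zero linear form on `𝔽₃^s`**: `3 · #{col : ⟨ξ, col⟩ = 0} = 3^s`. -/
theorem three_mul_card_orth (ξ : Fin s → ZMod 3) (hξ : ξ ≠ 0) :
    3 * ((univ.filter fun col : Fin s → ZMod 3 => (∑ k, ξ k * col k) = 0).card : ℝ) = (3 : ℝ) ^ s := by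
  -- the count as a character sum, in `ℂ`
  have hind : ∀ col : Fin s → ZMod 3, (if (∑ k, ξ k * col k) = 0 then (3 : ℂ) else 0)
      = ∑ t : ZMod 3, (ZMod.stdAddChar (∑ k, col k * (ξ k * t)) : ℂ) := by
    intro col
    rw [← sum_stdAddChar_three (∑ k, ξ k * col k)]
    refine sum_congr rfl fun t _ => ?_
    congr 2
    rw [sum_mul]
    exact sum_congr rfl fun k _ => by ring
  have hC : (3 : ℂ) * ((univ.filter fun col : Fin s → ZMod 3 => (∑ k, ξ k * col k) = 0).card : ℂ)
      = (3 : ℂ) ^ s := by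
    have h1 : (3 : ℂ) * ((univ.filter fun col : Fin s → ZMod 3 => (∑ k, ξ k * col k) = 0).card : ℂ)
        = ∑ col : Fin s → ZMod 3, (if (∑ k, ξ k * col k) = 0 then (3 : ℂ) else 0) := by
      rw [Finset.sum_ite, sum_const_zero, add_zero, sum_const, nsmul_eq_mul, mul_comm]
    rw [h1, sum_congr rfl fun col _ => hind col, sum_comm]
    have h2 : ∀ t : ZMod 3, ∑ col : Fin s → ZMod 3, (ZMod.stdAddChar (∑ k, col k * (ξ k * t)) : ℂ)
        = if t = 0 then (3 : ℂ) ^ s else 0 := by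
      intro t
      rw [TwoModuli.sum_stdAddChar_dot_eq_ite (fun k => ξ k * t)]
      by_cases ht : t = 0
      · subst ht
        have h0 : (fun k => ξ k * (0 : ZMod 3)) = 0 := funext fun k => by simp
        rw [if_pos h0, if_pos rfl]
        push_cast
        rfl
      · have hne : (fun k => ξ k * t) ≠ 0 := by
          intro h0
          apply hξ
          funext k
          have := congrFun h0 k
          simp only [Pi.zero_apply, mul_eq_zero] at this
          rcases this with h | h
          · exact h
          · exact absurd h ht
        rw [if_neg hne, if_neg ht]
    simp_rw [h2]
    rw [Finset.sum_ite_eq' univ (0 : ZMod 3)]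
    simp
  exact_mod_cast hC

/-- The one-column factor: `Σ_{col ∈ 𝔽₃^s} 2^{−[⟨ξ,col⟩ ≠ 0]} = (2/3)·3^s` for `ξ ≠ 0`. -/
theorem sum_col_weight (ξ : Fin s → ZMod 3) (hξ : ξ ≠ 0) :
    ∑ col : Fin s → ZMod 3, (if (∑ k, ξ k * col k) ≠ 0 then (2 : ℝ)⁻¹ else 1) = 2 / 3 * (3 : ℝ) ^ s := by
  have hZ := three_mul_card_orth ξ hξ
  have hsplit : ∑ col : Fin s → ZMod 3, (if (∑ k, ξ k * col k) ≠ 0 then (2 : ℝ)⁻¹ else 1)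
      = (2 : ℝ)⁻¹ * (univ.filter fun col : Fin s → ZMod 3 => (∑ k, ξ k * col k) ≠ 0).card
        + (univ.filter fun col : Fin s → ZMod 3 => (∑ k, ξ k * col k) = 0).card := by
    rw [Finset.sum_ite, sum_const, sum_const, nsmul_eq_mul, nsmul_eq_mul, mul_one, mul_comm]
    congr 2
    exact congrArg _ (filter_congr fun col _ => by simp)
  have htot : ((univ.filter fun col : Fin s → ZMod 3 => (∑ k, ξ k * col k) ≠ 0).card : ℝ)
      + (univ.filter fun col : Fin s → ZMod 3 => (∑ k, ξ k * col k) = 0).card = (3 : ℝ) ^ s := by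
    have h := Finset.card_filter_add_card_filter_not (s := (univ : Finset (Fin s → ZMod 3)))
      (fun col => (∑ k, ξ k * col k) ≠ 0)
    rw [card_univ, Fintype.card_fun, ZMod.card, Fintype.card_fin] at h
    have h' : ((univ.filter fun col : Fin s → ZMod 3 => (∑ k, ξ k * col k) ≠ 0).card : ℝ)
        + ((univ.filter fun col : Fin s → ZMod 3 => ¬ (∑ k, ξ k * col k) ≠ 0).card : ℝ) = (3 : ℝ) ^ s := by
      exact_mod_cast h
    rw [← h']
    congr 2
    exact congrArg _ (filter_congr fun col _ => by simp)
  rw [hsplit]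
  linarith

end AffBells21

end Summit.QuantumAdvantage.AdviceFreeQNC0
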